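import Summits.BirchSwinnertonDyer.BirchSwinnertonDyer.Theorems.AlignedTransportAtTwoMainConjectureOfRankZeroBSDAtTwoResolventParity
import Literature.NumberTheory.QuadraticFields.ImaginaryQuadraticTwoRank
import HarnessLib

/-!
# Route `AlignedTransportAtTwo`, crux C2 `MainConjectureOfRankZeroBSDAtTwo` (stmt-BirchSwinnertonDyer-22298):
# THE LAYER-0 CENSUS CHECK IN CLOSED FORM — for `Δ_W < 0`, `rank₂ Cl(ℚ(W[2])) ≡ ω(|d|) − 1 (mod 2)` and `rank₂ Cl(ℚ(W[2])) ≥ ω(|d|) − 1`,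
# `d` = the discriminant of the resolvent `ℚ(√Δ_W)` (Gauss's genus count + this seat's resolvent parity law)

HONEST FRAMING (cell `bsd-f1-sign2`, WIDTH-5 attached prover seat `bsd-line-att-p3` gen 29, line `birth`, lead `bsd-line-att-p2`; `--supports`
stmt-BirchSwinnertonDyer-22298, closes nothing; BSD is NOT proved; crux C2, its verdict «blocked-on `Rank1Residual.GreenbergMuConjectureIrreducible`» and every
registered stub untouched).  THEOREMS ONLY — no definition, no named fact, no `sorry`; UNCONDITIONAL.

For an elliptic `W/ℚ` with `Δ_W < 0` and `δ² = Δ_W` the resolvent `K = ℚ(δ)` is imaginary quadratic; Gauss (Cox Prop. 3.11 / Thm. 3.15, tree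
`QuadraticFields.AmbiguousClasses`, rank form `Quadratic.padicValNat_two_card_quotient_sq_eq_card_primeFactors_discr_sub_one` of this seat): `rank₂ Cl(K) = ω(|d_K|) − 1`
(`ω` = number of distinct prime divisors of the field discriminant `d_K`).  This seat's `…ResolventParity` (`rank₂ Cl(ℚ(W[2])) ≡ rank₂ Cl(K) (mod 2)`,
`rank₂ Cl(K) ≤ rank₂ Cl(ℚ(W[2]))`) turns it into a CLOSED-FORM check on every census row «`rank₂ Cl(ℚ(W[2])) = r₀`» of the `Δ_W < 0` cell (g27/g28 asked
`-data` for these ranks; g28: a certificate at the pair `(0,1)` needs `r₀ ≥ 3`):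

* ★ `rankTwo_classGroup_divisionField_two_mod_two_eq_of_Δ_neg` — **`rank₂ Cl(ℚ(W[2])) ≡ ω(|d_{ℚ(√Δ_W)}|) − 1 (mod 2)` and `ω(|d|) − 1 ≤ rank₂ Cl(ℚ(W[2]))`**;
* `odd_rankTwo_classGroup_divisionField_two_iff_even_card_primeFactors` — `rank₂ Cl(ℚ(W[2]))` is ODD iff `ω(|d_{ℚ(√Δ_W)}|)` is EVEN;
* `three_le_rankTwo_classGroup_divisionField_two_of_four_le` — `ω ≥ 4 ⟹ rank₂ Cl(ℚ(W[2])) ≥ 3` (the g28 threshold for a `(0,1)` certificate is met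
  for free when at least four primes ramify in the resolvent).

References: [Cox2013] §3.B Prop. 3.11, Thm. 3.15; [Washington1997] Thm. 10.8; tree `QuadraticFields/AmbiguousClasses.lean`, this seat's p761326 / p761618 and
`Literature/NumberTheory/QuadraticFields/ImaginaryQuadraticTwoRank.lean`.
-/

set_option linter.dupNamespace false
set_option autoImplicit false

noncomputable section

open scoped Classical NumberField

namespace Summit.BirchSwinnertonDyer.BirchSwinnertonDyer.Theorems.AlignedTransportAtTwoResolventGenusParity

open Polynomial WeierstrassCurve IntermediateField Field NumberField
  Literature.NumberTheory.EllipticCurves Literature.NumberTheory.NumberFields Literature.NumberTheory.QuadraticFields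
  Summit.BirchSwinnertonDyer.BirchSwinnertonDyer.Theorems.AlignedTransportAtTwoCubicClosureParity
  Summit.BirchSwinnertonDyer.BirchSwinnertonDyer.Theorems.AlignedTransportAtTwoResolventParity

variable (W : WeierstrassCurve ℚ) [W.IsElliptic]

omit [W.IsElliptic] in
/-- The resolvent `ℚ(δ)`, `δ² = Δ_W < 0`, is an imaginary quadratic field. [cite: Cox2013, §3.B (imaginary quadratic fields)] -/
theorem isImaginaryQuadratic_resolvent (hΔ : W.Δ < 0) {δ : AlgebraicClosure ℚ} (hδ : δ ^ 2 = ((W.Δ : ℚ) : AlgebraicClosure ℚ))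
    [NumberField ℚ⟮δ⟯] : IsImaginaryQuadratic ℚ⟮δ⟯ := by
  have hsq : ¬ IsSquare W.Δ := fun ⟨r, hr⟩ ↦ by nlinarith [mul_self_nonneg r]
  have hgen : (AdjoinSimple.gen ℚ δ) ^ 2 = algebraMap ℚ ℚ⟮δ⟯ W.Δ := by
    apply (algebraMap ℚ⟮δ⟯ (AlgebraicClosure ℚ)).injective
    rw [map_pow, AdjoinSimple.algebraMap_gen, hδ, ← IsScalarTower.algebraMap_apply, eq_ratCast]
  exact IsImaginaryQuadratic.of_sq_eq (finrank_adjoin_eq_two_of_sq_eq hδ hsq) hgen hΔ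

/-- ★ **The layer-0 census check in closed form.**  `W/ℚ` elliptic with `Δ_W < 0`, `δ² = Δ_W`, `d = disc ℚ(δ)`: **`rank₂ Cl(ℚ(W[2])) ≡ ω(|d|) − 1 (mod 2)`
and `ω(|d|) − 1 ≤ rank₂ Cl(ℚ(W[2]))`** (`rank₂ M = v₂ #(M/M²)`; Gauss `rank₂ Cl(ℚ(δ)) = ω(|d|) − 1` + the resolvent parity law).
[cite: Cox2013, §3.B Prop. 3.11 and Thm. 3.15] [cite: Washington1997, Thm. 10.8] -/
theorem rankTwo_classGroup_divisionField_two_mod_two_eq_of_Δ_neg (hΔ : W.Δ < 0) {δ : AlgebraicClosure ℚ}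
    (hδ : δ ^ 2 = ((W.Δ : ℚ) : AlgebraicClosure ℚ)) [NumberField ℚ⟮δ⟯] [NumberField (W.divisionField 2)] :
    padicValNat 2 (Nat.card (ClassGroup (𝓞 (W.divisionField 2)) ⧸ (powMonoidHom 2 : ClassGroup (𝓞 (W.divisionField 2)) →* _).range)) % 2 =
        ((NumberField.discr ℚ⟮δ⟯).natAbs.primeFactors.card - 1) % 2 ∧
      (NumberField.discr ℚ⟮δ⟯).natAbs.primeFactors.card - 1 ≤
        padicValNat 2 (Nat.card (ClassGroup (𝓞 (W.divisionField 2)) ⧸ (powMonoidHom 2 : ClassGroup (𝓞 (W.divisionField 2)) →* _).range)) := by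
  have hsq : ¬ IsSquare W.Δ := fun ⟨r, hr⟩ ↦ by nlinarith [mul_self_nonneg r]
  obtain ⟨hmod, hle⟩ := rankTwo_classGroup_divisionField_two_modEq_two W hsq hδ
  have hG := Quadratic.padicValNat_two_card_quotient_sq_eq_card_primeFactors_discr_sub_one (isImaginaryQuadratic_resolvent W hΔ hδ)
  rw [hG] at hmod hle
  exact ⟨hmod, hle⟩

/-- **`rank₂ Cl(ℚ(W[2]))` is ODD iff an EVEN number of primes divide the discriminant of `ℚ(√Δ_W)`** (`Δ_W < 0`; `ω ≥ 1` always).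
[cite: Cox2013, §3.B Prop. 3.11 and Thm. 3.15] [cite: Washington1997, Thm. 10.8] -/
theorem odd_rankTwo_classGroup_divisionField_two_iff_even_card_primeFactors (hΔ : W.Δ < 0) {δ : AlgebraicClosure ℚ}
    (hδ : δ ^ 2 = ((W.Δ : ℚ) : AlgebraicClosure ℚ)) [NumberField ℚ⟮δ⟯] [NumberField (W.divisionField 2)]
    (hω : 1 ≤ (NumberField.discr ℚ⟮δ⟯).natAbs.primeFactors.card) :
    Odd (padicValNat 2 (Nat.card (ClassGroup (𝓞 (W.divisionField 2)) ⧸ (powMonoidHom 2 : ClassGroup (𝓞 (W.divisionField 2)) →* _).range))) ↔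
      Even (NumberField.discr ℚ⟮δ⟯).natAbs.primeFactors.card := by
  obtain ⟨hmod, -⟩ := rankTwo_classGroup_divisionField_two_mod_two_eq_of_Δ_neg W hΔ hδ
  rw [Nat.odd_iff, Nat.even_iff, hmod]
  omega

/-- **`ω(|d_{ℚ(√Δ_W)}|) ≥ 4 ⟹ rank₂ Cl(ℚ(W[2])) ≥ 3`** (`Δ_W < 0`): the g28 threshold «a certificate at the pair `(0,1)` needs `rank₂ Cl(ℚ(W[2])) ≥ 3`» is met for free
when at least four primes ramify in the resolvent. [cite: Cox2013, §3.B Prop. 3.11 and Thm. 3.15] -/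
theorem three_le_rankTwo_classGroup_divisionField_two_of_four_le (hΔ : W.Δ < 0) {δ : AlgebraicClosure ℚ}
    (hδ : δ ^ 2 = ((W.Δ : ℚ) : AlgebraicClosure ℚ)) [NumberField ℚ⟮δ⟯] [NumberField (W.divisionField 2)]
    (h4 : 4 ≤ (NumberField.discr ℚ⟮δ⟯).natAbs.primeFactors.card) :
    3 ≤ padicValNat 2 (Nat.card (ClassGroup (𝓞 (W.divisionField 2)) ⧸ (powMonoidHom 2 : ClassGroup (𝓞 (W.divisionField 2)) →* _).range)) := by
  obtain ⟨-, hle⟩ := rankTwo_classGroup_divisionField_two_mod_two_eq_of_Δ_neg W hΔ hδ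
  omega

end Summit.BirchSwinnertonDyer.BirchSwinnertonDyer.Theorems.AlignedTransportAtTwoResolventGenusParity

end
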